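import Summits.ResolutionOfSingularities.ResolutionOfSingularities.Theorems.EquisingularLiftEquisingularLiftNatDEvenTower
import HarnessLib

/-!
# [OURS] `D₄` VERTICES `y₀²y₁ + y₀y₁² + y₂²` ⟹ `IsoHypPoint`, EVERY CHARACTERISTIC (`K = K̄`) — the vertex corollary of ✓ `towerLevel_origin_D₄`
# (cruxes `Theses.EquisingularLift.EquisingularLiftNat` / `…NatThree` / `EquisingularLift`, stmt-ResolutionOfSingularities-20038 / -20148 / -15660)

[OURS · leafhand-res-equisingularlift-12 g1, 2026-09-01; cell `pub/decomp-res`] AI-produced, weaker than expert review; NOT a statement of any manuscript;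
nothing here proves resolution of singularities in positive characteristic.  DEF-FREE helper; no `sorry`; standard axioms; ZERO named hypotheses.

leafhand-12 g0's ✓ `isoHypPoint_of_D₄Vertices` treats the specimen `y₀² + y₁³ + y₂³` and needs `2, 3 ≠ 0` and cube roots of `-1`.  The rational normal form
`y₂² + y₀y₁(y₀ + y₁)` of ✓ `towerLevel_origin_D₄` (four nodes over the origin at RATIONAL marks) gives the same corollary in EVERY characteristic,
including `2` and `3` (where `y₀y₁(y₀+y₁)` still has three distinct tangent directions):

* `SecondOrderPoint.D₄'_singular_only_origin` — the affine surface `y₀²y₁ + y₀y₁² + y₂² = 0` is singular only at the origin, EVERY characteristic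
  (prime-ideal form; the proof splits `3 = 0` / `3 ≠ 0` in `K`);
* ★★ `isoHypPoint_of_D₄'Vertices` — `F ∈ K̄[x₀,…,x₃]` a prime form whose charts at the vertices `c ∈ S` are `y₀²y₁ + y₀y₁² + y₂²` and whose other charts
  are regular satisfies `IsoHypPoint` (✓ `isoHypPoint_of_towerVertices`, ✓ `towerLevel_vertex_of_origin`, ✓ `towerLevel_origin_D₄`).

Non-vacuity (by hand, not kernel-checked here): for `S = [3]` the only such prime form is the cubic surface `F = x₀x₁(x₀ + x₁) + x₂²x₃`, whose charts
`0, 1, 2` (`y₀(1+y₀) + y₁²y₂`, its mirror, `y₀²y₁ + y₀y₁² + y₂`) are regular in every characteristic — a cubic surface with exactly one singular point,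
of type `D₄`.  (By contrast the exact trinomial vertex charts of degree `≥ 4` — `A_{n≥3}`, `D_{n≥5}`, `E_n` — force `F` singular along `{x₂ = x₃ = 0}`,
so the analogous corollaries are vacuous; see the headers of ✓ `…NatDEvenTower`, ✓ `…NatESeriesTower`.)  Closes no registered stub.

References: [Hartshorne1977, I Thm. 5.1, I Ex. 5.6, II Ex. 7.12]; [BruceWall1979, §2 (cubic surfaces with a D₄ point)]; [StacksProject, Tags 0804, 080E];
through the cited tree files.
-/

set_option linter.dupNamespace false -- mandated namespace `Summit.<Summit>.<Problem>` of this single-conjunct summit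

noncomputable section

open CategoryTheory CategoryTheory.Limits AlgebraicGeometry TopologicalSpace Topology
open MvPolynomial
open Literature.AlgebraicGeometry.Resolution Literature.AlgebraicGeometry.Motives
open AlgebraicGeometry.Scheme.IdealSheafData
open Literature.AlgebraicGeometry.Motives.SmoothHypersurface Literature.AlgebraicGeometry.Motives.ProjectiveSpace
open Summit.ResolutionOfSingularities.ResolutionOfSingularities.Cruxes.EquisingularLift.StrataSplit

namespace Summit.ResolutionOfSingularities.ResolutionOfSingularities.Cruxes.EquisingularLiftNat.Sections

namespace SecondOrderPoint

variable (K : Type) [Field K]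

/-- The partials of `f = y₀²y₁ + y₀y₁² + y₂²`: `∂₀ = y₁(2y₀ + y₁)`, `∂₁ = y₀(y₀ + 2y₁)`, `∂₂ = 2y₂`. [folklore] -/
theorem D₄'_pderiv :
    pderiv 0 (X 0 ^ 2 * X 1 + X 0 * X 1 ^ 2 + X 2 ^ 2 : MvPolynomial (Fin 3) K) = X 1 * (X 0 + X 0 + X 1) ∧
    pderiv 1 (X 0 ^ 2 * X 1 + X 0 * X 1 ^ 2 + X 2 ^ 2 : MvPolynomial (Fin 3) K) = X 0 * (X 0 + X 1 + X 1) ∧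
    pderiv 2 (X 0 ^ 2 * X 1 + X 0 * X 1 ^ 2 + X 2 ^ 2 : MvPolynomial (Fin 3) K) = X 2 + X 2 := by
  refine ⟨?_, ?_, ?_⟩
  · simp only [map_add, pderiv_mul, pderiv_pow, pderiv_X_self, pderiv_X_of_ne (by decide : (1 : Fin 3) ≠ 0),
      pderiv_X_of_ne (by decide : (2 : Fin 3) ≠ 0)]
    ring
  · simp only [map_add, pderiv_mul, pderiv_pow, pderiv_X_self, pderiv_X_of_ne (by decide : (0 : Fin 3) ≠ 1),
      pderiv_X_of_ne (by decide : (2 : Fin 3) ≠ 1)]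
    ring
  · simp only [map_add, pderiv_mul, pderiv_pow, pderiv_X_self, pderiv_X_of_ne (by decide : (0 : Fin 3) ≠ 2),
      pderiv_X_of_ne (by decide : (1 : Fin 3) ≠ 2)]
    ring

/-- ★ **The affine `D₄` surface `y₀²y₁ + y₀y₁² + y₂² = 0` is singular only at the origin, in EVERY characteristic**: a prime containing `f` and its three
partials contains every variable (for `3 = 0` in `K` one uses `2 ≠ 0` and `f - y₂² = y₀y₁(y₀+y₁)`; otherwise `3y₀ = 2∂-combination`).
[cite: Hartshorne1977, I Thm. 5.1] -/
theorem D₄'_singular_only_origin (P : Ideal (MvPolynomial (Fin 3) K)) (hP : P.IsPrime)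
    (hf : (X 0 ^ 2 * X 1 + X 0 * X 1 ^ 2 + X 2 ^ 2 : MvPolynomial (Fin 3) K) ∈ P)
    (hd : ∀ j, pderiv j (X 0 ^ 2 * X 1 + X 0 * X 1 ^ 2 + X 2 ^ 2 : MvPolynomial (Fin 3) K) ∈ P) (j : Fin 3) :
    (X j : MvPolynomial (Fin 3) K) ∈ P := by
  obtain ⟨e0, e1, e2⟩ := D₄'_pderiv K
  have ha : (X 1 * (X 0 + X 0 + X 1) : MvPolynomial (Fin 3) K) ∈ P := by rw [← e0]; exact hd 0
  have hb : (X 0 * (X 0 + X 1 + X 1) : MvPolynomial (Fin 3) K) ∈ P := by rw [← e1]; exact hd 1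
  have hc : (X 2 + X 2 : MvPolynomial (Fin 3) K) ∈ P := by rw [← e2]; exact hd 2
  -- key step: one of `y₀`, `y₁` lies in `P`
  have key : (X 0 : MvPolynomial (Fin 3) K) ∈ P ∨ (X 1 : MvPolynomial (Fin 3) K) ∈ P := by
    rcases hP.mem_or_mem ha with h1 | ha'
    · exact Or.inr h1
    rcases hP.mem_or_mem hb with h0 | hb'
    · exact Or.inl h0
    have h3 : (C (3 : K) * X 0 : MvPolynomial (Fin 3) K) ∈ P := by
      have e : (C (3 : K) * X 0 : MvPolynomial (Fin 3) K) = C (2 : K) * (X 0 + X 0 + X 1) - (X 0 + X 1 + X 1) := by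
        rw [map_ofNat, map_ofNat]; ring
      rw [e]; exact P.sub_mem (P.mul_mem_left _ ha') hb'
    by_cases h3K : (3 : K) = 0
    · have h2K : (2 : K) ≠ 0 := by
        intro h2
        have h : (3 : K) - 2 = 0 - 0 := by rw [h3K, h2]
        norm_num at h
      have hX2 : (X 2 : MvPolynomial (Fin 3) K) ∈ P := by
        refine mem_of_C_mul_mem K h2K P hP ?_
        have e : (C (2 : K) * X 2 : MvPolynomial (Fin 3) K) = X 2 + X 2 := by rw [map_ofNat]; ring
        rw [e]; exact hc
      have hprod : (X 0 * X 1 * (X 0 + X 1) : MvPolynomial (Fin 3) K) ∈ P := by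
        have e : (X 0 * X 1 * (X 0 + X 1) : MvPolynomial (Fin 3) K) = (X 0 ^ 2 * X 1 + X 0 * X 1 ^ 2 + X 2 ^ 2) - X 2 * X 2 := by ring
        rw [e]; exact P.sub_mem hf (P.mul_mem_left _ hX2)
      rcases hP.mem_or_mem hprod with h01 | hs
      · exact hP.mem_or_mem h01
      · left
        have e : (X 0 : MvPolynomial (Fin 3) K) = (X 0 + X 0 + X 1) - (X 0 + X 1) := by ring
        rw [e]; exact P.sub_mem ha' hs
    · exact Or.inl (mem_of_C_mul_mem K h3K P hP h3)
  have h01 : (X 0 : MvPolynomial (Fin 3) K) ∈ P ∧ (X 1 : MvPolynomial (Fin 3) K) ∈ P := by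
    rcases key with h0 | h1
    · refine ⟨h0, ?_⟩
      rcases hP.mem_or_mem ha with h1 | ha'
      · exact h1
      · have e : (X 1 : MvPolynomial (Fin 3) K) = (X 0 + X 0 + X 1) - (X 0 + X 0) := by ring
        rw [e]; exact P.sub_mem ha' (P.add_mem h0 h0)
    · refine ⟨?_, h1⟩
      rcases hP.mem_or_mem hb with h0 | hb'
      · exact h0
      · have e : (X 0 : MvPolynomial (Fin 3) K) = (X 0 + X 1 + X 1) - (X 1 + X 1) := by ring
        rw [e]; exact P.sub_mem hb' (P.add_mem h1 h1)
  have hX2 : (X 2 : MvPolynomial (Fin 3) K) ∈ P := by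
    refine hP.mem_of_pow_mem 2 ?_
    have e : (X 2 ^ 2 : MvPolynomial (Fin 3) K) = (X 0 ^ 2 * X 1 + X 0 * X 1 ^ 2 + X 2 ^ 2) - X 0 * (X 0 * X 1 + X 1 ^ 2) := by ring
    rw [e]; exact P.sub_mem hf (P.mul_mem_right _ h01.1)
  fin_cases j
  · simpa using h01.1
  · simpa using h01.2
  · simpa using hX2

end SecondOrderPoint

/-- ★★ **`D₄` VERTICES `y₀²y₁ + y₀y₁² + y₂²` OF A PRIME SURFACE OVER `K̄` ⟹ `IsoHypPoint`, EVERY CHARACTERISTIC**: `F ∈ K[x₀,…,x₃]` a prime form whose charts at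
the vertices `c ∈ S` are `y₀²y₁ + y₀y₁² + y₂²` and whose other charts are regular. [OURS] [cite: Hartshorne1977, I Thm. 5.1, I Ex. 5.6]
[cite: StacksProject, Tag 080E] -/
theorem isoHypPoint_of_D₄'Vertices (K : Type) [Field K] [IsAlgClosed K]
    (F : MvPolynomial (Fin (1 + 2 + 1)) K) {d : ℕ} (hF : F.IsHomogeneous d) (hFp : Prime F) (S : List (Fin (1 + 2 + 1)))
    (hD₄ : ∀ c ∈ S, ProjectiveSpace.dehomogenize K c F = X 0 ^ 2 * X 1 + X 0 * X 1 ^ 2 + X 2 ^ 2)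
    (hoff : letI := MvPolynomial.gradedAlgebra (σ := Fin (1 + 2 + 1)) (R := K)
      ∀ c, c ∉ S → IsRegularRing (ChartRing F c hF)) :
    letI := MvPolynomial.gradedAlgebra (σ := Fin (1 + 2 + 1)) (R := K)
    IsoHypPoint K (1 + 2) (hypersurface F).left (hypersurfaceι F).left := by
  obtain ⟨D, hD0, hDsucc⟩ := exists_blowupTower
  have hd : 0 < d := ConeN.pos_of_prime_of_isHomogeneous K F hF hFp
  have hΦ : (X 2 ^ 2 : MvPolynomial (Fin 3) K).IsHomogeneous 2 := isHomogeneous_X_pow (2 : Fin 3) 2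
  have hΨ := SecondOrderPoint.D_even_tail_mem_pow K 0
  have hA : ∀ c ∈ S, ProjectiveSpace.dehomogenize K c F = X 2 ^ 2 + (X 0 ^ 2 * X 1 + X 0 * X 1 ^ (0 + 2)) := fun c hc => by
    rw [hD₄ c hc]; ring
  refine isoHypPoint_of_towerVertices K D hD0 hDsucc F hF hFp S (fun c hc => ⟨2, X 2 ^ 2, _, le_rfl, hΦ, hΨ, hA c hc⟩)
    (fun c hc P hP hfP hdP j => ?_) hoff (fun c hc => ?_)
  · rw [hD₄ c hc] at hfP hdP
    exact SecondOrderPoint.D₄'_singular_only_origin K P hP hfP hdP j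
  · have hrad : (Ideal.span {(X 2 ^ 2 + (X 0 ^ 2 * X 1 + X 0 * X 1 ^ (0 + 2)) : MvPolynomial (Fin 3) K)}).radical =
        Ideal.span {(X 2 ^ 2 + (X 0 ^ 2 * X 1 + X 0 * X 1 ^ (0 + 2)) : MvPolynomial (Fin 3) K)} :=
      OrdPointAt.radical_span_dehomogenize_eq K F c hF hFp (X 2 ^ 2) _ hΦ (by norm_num) hΨ (hA c hc)
    obtain ⟨x₀, -, hx₀X, hlev⟩ := towerLevel_vertex_of_origin K D hD0 hDsucc 1 F hF hd c (X 2 ^ 2) _ (by norm_num) hΦ hΨ (hA c hc) hrad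
      (fun y hy => OneStep.towerLevel_origin_D₄ K D hD0 hDsucc _ (by ring) y hy)
    exact ⟨x₀, hx₀X, 1, hlev⟩

end Summit.ResolutionOfSingularities.ResolutionOfSingularities.Cruxes.EquisingularLiftNat.Sections

end
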